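/-
Copyright (c) 2026 the pub-hodgecm-mathlib formalisation cell (harness21).  Prover seat hodgecm-mathlib-F0P2-p01 (g12), programme P2,
row «ENGINE-GEN» (ii) of ROAD Θ-GEN-P4 for the desk's OCC♭-GEN line (stub Θ-OCC-GEN `StubThetaOccursInGen`), 2026-09-01.
KERNEL module: THEOREMS ONLY (no definition, no named fact, no `sorry`, no instance, no notation).
-/
import Summits.HodgeConjecture.HodgeConjecture.Theorems.F0P2sThetaOccursInEngineGen       -- (i) ★ the S4b engine off the pin
import Summits.HodgeConjecture.HodgeConjecture.Theorems.F0P2sThetaOccursInOutputAdapter    -- ★ p844332 (Ta)∘(Tf) output adapter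
import Summits.HodgeConjecture.HodgeConjecture.Theorems.F0P2sThetaOccursInLineTransport    -- ★ p844221 R3 admissible representative + line transport
import Summits.HodgeConjecture.HodgeConjecture.Theorems.F0P2OccGenCotangentOfOccursIn      -- ★ p844131 packaging `cmFieldOf` ∕ `hermSpace3Of`
import Literature.NumberTheory.Automorphic.Liu2021.Def411WeilCarriersAtLineReindex        -- ★ enumeration independence of `ω(μ,ε,χ)` at a line
import Summits.HodgeConjecture.HodgeCM.Proofs.LandherrCompact                               -- ★ `isAnisotropic_iff_finrank_ne_two`
import Summits.HodgeConjecture.HodgeConjecture.Theorems.F0P3HolProjectionReduction         -- ★ `four_le_finrank_of_two_le`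
import HarnessLib

/-!
# FLOOR-0 P2 · ENGINE-GEN (ii): Θ-OCC-GEN's `∃ θ`-clause AT A GENERAL FRAME from the engine's `(χ)`+`(N)` row — the composite
# «hadm ↦ (a′) ↦ (P)(An) ↦ engine (i) at a′ ↦ (Ta) ↦ (Tf) ↦ reindex ↦ pull back» of CENSUS-OCCGEN-B2 §2, all ★ by name

Cell hodgecm-mathlib (D-0151), FLOOR 0; crux item H413 = stmt-HodgeConjecture-24833 (route `HCCMUnconditional`, no route verbs); programme P2, the
OCC♭-GEN pay-down line `Cruxes/H413/Lines/F0_P2OccFlatGeneral.lean` (ED. 2), its one letter Θ-OCC-GEN `stub_thetaOccursInGen : StubThetaOccursInGen`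
(books #173, UNPROVED L).  THEOREMS ONLY; `--supports stmt-HodgeConjecture-24833`.  Sequel of (i) ★ `Theorems/F0P2sThetaOccursInEngineGen`
(`exists_holTheta_atFrame_of_chiN`: the S4b engine off the pin).

* §1 **`thetaOccursInClause_of_reindex`** — ENUMERATION TRANSPORT of the `∃ θ`-clause: the clause at an enumeration `e′ : Fin N × Fin 1 ≃ Fin n′` of
  `V ⊗ W` gives the clause at any other enumeration `e` (`θ := θ′ ∘ Ψ` for the ★ on-the-nose equivariant `Ψ : ω[e] ≃ ω[e′]` of
  `Def411WeilCarriersDoubling.exists_omegaAtLine_equiv_rhoVAtLine_reindex`); any rank `N`, any `ιV`, any value module `A`.  Needed because the engine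
  (P4's model) lives at the fixed enumeration `HodgeCM.Model.ArchSideTerm.e₁ = Equiv.prodUnique (Fin 3) (Fin 1)` while the letter quantifies over `e₁`.
* §2 **`thetaOccursInGen_caseA_of_chiN`** — `StubThetaOccursInGen` IN ORIENTATION CASE A: its body (`Lines/F0_P2OccFlatGeneral.lean` :152–188) with the
  two orientation hypotheses `(InfinitePlace.mk ι).embedding = ι` and `ι ∈ hμ.cmType.1` inserted before the `∃ θ`-clause, everything else token for
  token, FROM the χN-GEN row `hX` (= the hypothesis `hχN` of (i) at the seesaw label `Φ := hμ.cmType`, universally closed over packaged anisotropic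
  frames `(F, V)` with `(mk ι₁).embedding = ι₁`, conjugate-symplectic weight-one `μ` with `ι₁ ∈ Φ_μ`, `χ`, admissible lines `(e, a)`).  Proof: ★ R3
  `thetaOccursInClause_of_admissibleRepresentative` reduces to an admissible representative `a′`; anisotropy (An) from `2 ≤ [L⁺:ℚ]` (★
  `four_le_finrank_of_two_le`, ★ `isAnisotropic_iff_finrank_ne_two`); (i) at `(cmFieldOf L, hermSpace3Of …, a′)` gives the clause at the pin frame
  `(frameD, ιVE)` and the model enumeration, valued in `holCotForms (archFactorOf …)`; ★ p844332 `thetaOccursInClause_of_pinFrame_archFactorOf` moves it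
  to `(dV, g, ιV)` and `cohForms (cmArchSection, cmCompactFactor)` (`K (cmFieldOf L) = L`, `Hm (hermSpace3Of …) = H` by `rfl`); §1 moves the enumeration
  to the letter's `e₁`.  So `stub_thetaOccursInGen` ⟸ {χN-GEN `hX`, ORIENT-GEN (the complement of Case A)}.

HONEST RESIDUALS of Θ-OCC-GEN after (i)+(ii) — exactly the hypotheses of §2: (R1a) `hemb` (the model is written at the canonical representative
of the place), (R1b) `hι : ι ∈ Φ_μ` (otherwise the lift is antiholomorphic at `ι`, [Liu2021, Lem. D.2 (2)], and the HOL engine does not apply), (R2)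
χN-GEN `hχN` (Rallis ★ CM + (A-PIN) + (FIN) + brick 7 off the pin).  Nothing of print is asserted here; HC_CM is proved only modulo the printed
citations until rung 0 closes.

## References
* [Liu2021] Y. Liu, *Fourier–Jacobi cycles and arithmetic relative trace formula*, Camb. J. Math. 9 (2021) = arXiv:2102.11518: Prop. 4.13 («Conversely»
  l. 2145–2149); Def. 4.11 (l. 2092–2096), Def. 4.12 (l. 2102–2108); App. D §D.1 Step 1 footnote (l. 5215), Steps 2–3, Lem. D.2.
* [GelbartRogawski1991] S. Gelbart, J. Rogawski, Invent. Math. 105 (1991), §3.1 Prop. 3.1.1 p. 455; Remark p. 457 L4–13.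
* [MoeglinVignerasWaldspurger1987] Chap. 2 II.1, Chap. 3 I.1–I.3.  [BorelJacquet1979] §4.1, §4.2.  [PlatonovRapinchuk1994] §5.1.
-/

set_option autoImplicit false

-- the mandated namespace has the single-problem summit's repeated segment (`HodgeConjecture.HodgeConjecture`)
set_option linter.dupNamespace false

noncomputable section

open MulAction NumberField NumberField.InfinitePlace NumberField.mixedEmbedding IsDedekindDomain
open scoped SchwartzMap TensorProduct Classical Matrix ComplexOrder
open Literature.NumberTheory.Automorphic Literature.NumberTheory.Automorphic.UnitaryGroup Literature.NumberTheory.Weil1964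
open Literature.NumberTheory.Automorphic.UnitaryGroup.CotangentForms
open Literature.NumberTheory.Automorphic.IdeleClassGroup
open Literature.Geometry.ComplexHyperbolic.BallModel (U21 x₀)
open Literature.AlgebraicGeometry.ShimuraVarieties
open Literature.AlgebraicGeometry.Motives (CMType)
open Literature.NumberTheory.GelbartRogawski1991 Literature.NumberTheory.GelbartRogawski1991.UnitaryDualPair
open Literature.NumberTheory.GelbartRogawski1991.UnitaryDualPair.WeilCoinv (commute_comp_inl_comp_inr finPairToAdelic finPairRep)
open Literature.NumberTheory.Automorphic.Liu2021
open Literature.NumberTheory.Automorphic.Liu2021.Def411WeilCarriers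
open Literature.NumberTheory.Automorphic.Liu2021.Def411WeilCarriersDoubling
open Literature.NumberTheory.GaloisRepresentations (HeckeCharacter)
open Literature.RepresentationTheory Literature.RepresentationTheory.Liu2021
open Literature.RepresentationTheory.HarrisKudlaSweet1996 (IsSplittingChar)
open HodgeCM HodgeCM.Adelic HodgeCM.PerL34 HodgeCM.Model HodgeCM.Model.ThetaSpace HodgeCM.Model.ArchSideTerm HodgeCM.Model.ThetaAdelicSide
open HodgeCM.Model.ThetaDistFin HodgeCM.Model.HypCensus HodgeCM.Model.LiuIndex HodgeCM.Model.TowerCarrier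
open HodgeCM.Model.SupplyResidual.WeilPairData (charInv)
open Literature.Analysis.SegalBargmann (binvPi)
open Literature.AlgebraicGeometry.ShimuraVarieties (BallForms.isPullbackCocycle_cotangentCocycle BallForms.expP)
open Literature.AlgebraicGeometry.Liu2021 (IsAdmissibleElement)
open Summit.HodgeConjecture.CorCM Summit.HodgeConjecture.CorCM.Model Summit.HodgeConjecture.CorCM.Transposition
open Summit.HodgeConjecture.CorCM.Transposition.OmegaChiSplitting (hsChiD)
open Summit.HodgeConjecture.HodgeConjecture.Cruxes.H413
open Summit.HodgeConjecture.HodgeConjecture.Cruxes.H413.ThetaJunction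
open Summit.HodgeConjecture.HodgeConjecture.Cruxes.H413.CohFormsCarriers
open Summit.HodgeConjecture.HodgeConjecture.Cruxes.H413.CuspCot
open Summit.HodgeConjecture.HodgeConjecture.Cruxes.H413.ThetaDistAtLine
open Summit.HodgeConjecture.HodgeConjecture.Cruxes.H413.AdmissibleLine
open Summit.HodgeConjecture.HodgeConjecture.Cruxes.H413.F0P2OccGenCotangentOfOccursIn (cmFieldOf hermSpace3Of)
open Summit.HodgeConjecture.HodgeConjecture.Cruxes.H413.F0P3HolProjectionReduction (four_le_finrank_of_two_le)

namespace Summit.HodgeConjecture.HodgeConjecture.Cruxes.H413.F0P2sThetaOccursInOfEngine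

/-! ## §1 Enumeration transport of the `∃ θ`-clause -/

section Reindex

variable (L : Type) [Field L] [NumberField L] [IsCMField L] (N : ℕ) (H : Matrix (Fin N) (Fin N) L)
  {n n' : ℕ} (e : Fin N × Fin 1 ≃ Fin n) (e' : Fin N × Fin 1 ≃ Fin n')
  (dV : Fin N → L) (hdV : ∀ i, IsCMField.complexConj L (dV i) = dV i) (hdV0 : ∀ i, dV i ≠ 0)
  (ιV : finAdelic (↥(maximalRealSubfield L)) L (IsCMField.complexConj L) N H →*
    finAdelic (↥(maximalRealSubfield L)) L (IsCMField.complexConj L) N (Matrix.diagonal dV))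
  (μ : Literature.NumberTheory.Automorphic.IdeleClassGroup L →ₜ* Circle) (hμ : IsConjugateSymplectic L μ)
  (a : (↥(maximalRealSubfield L))ˣ) (χ : Chi (↥(maximalRealSubfield L)) L (IsCMField.complexConj L))
  (A : Submodule ℂ ((adelicGroupData (↥(maximalRealSubfield L)) L (IsCMField.complexConj L) N H).Adelic → (Fin 2 → ℂ)))

set_option maxHeartbeats 1600000 in
/-- **ENUMERATION TRANSPORT of Θ-OCC-GEN's `∃ θ`-clause.**  If the clause holds at the enumeration `e′` of `V ⊗ W` — a NON-ZERO `ρ(a,χ)`-equivariant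
linear `θ′ : omegaAtLine[e′] a χ → (U(H)(𝔸_{L⁺}) → ℂ²)` with values in `A` — then it holds at any enumeration `e`: `θ := θ′ ∘ Ψ` for the ★ equivariant
linear equivalence `Ψ : ω[e] ≃ ω[e′]` of `exists_omegaAtLine_equiv_rhoVAtLine_reindex` ([Liu2021, Def. 4.11]: the carrier does not depend on the
enumeration).  Any rank `N`, any `ιV`, any `A`.
[cite: Liu2021, Def. 4.11 (l. 2092–2096); App. D §D.1 Step 1 footnote (l. 5215), Steps 2–3] [cite: GelbartRogawski1991, §3.1 Remark p. 457 L4–13]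
[cite: MoeglinVignerasWaldspurger1987, Chap. 2 II.1] -/
theorem thetaOccursInClause_of_reindex
    (h' : ∃ θ' : omegaAtLine (↥(maximalRealSubfield L)) L (IsCMField.complexConj L) N e' (Matrix.diagonal dV)
          (complexConj_imagUnit L) (imagUnit_ne_zero L) (imagUnit_mul_self L) (realDiagonal_isSymm L dV hdV)
          (isUnit_det_realDiagonal L dV hdV hdV0) (realDiagonal_map L dV hdV).symm
          (fun b => isCompatible_chiSplittingLine L e' dV hdV hdV0 (toHeckeCharacter L μ)
            (isUnitary_toHeckeCharacter L μ) ((isOscillatorChar_toHeckeCharacter_iff μ).mpr hμ)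
            (TW (↥(maximalRealSubfield L)) b) (isSymm_TW (↥(maximalRealSubfield L)) b)
            (isUnit_det_TW (↥(maximalRealSubfield L)) b) (JW (↥(maximalRealSubfield L)) L b)
            (JW_eq (↥(maximalRealSubfield L)) L b)) a χ →ₗ[ℂ]
        ((adelicGroupData (↥(maximalRealSubfield L)) L (IsCMField.complexConj L) N H).Adelic → (Fin 2 → ℂ)),
      θ' ≠ 0 ∧ (∀ w, θ' w ∈ A) ∧
        ∀ (k : finAdelic (↥(maximalRealSubfield L)) L (IsCMField.complexConj L) N H) (w),
          θ' (rhoAtLine (↥(maximalRealSubfield L)) L (IsCMField.complexConj L) N e' (Matrix.diagonal dV)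
              (complexConj_imagUnit L) (imagUnit_ne_zero L) (imagUnit_mul_self L) (realDiagonal_isSymm L dV hdV)
              (isUnit_det_realDiagonal L dV hdV hdV0) (realDiagonal_map L dV hdV).symm
              (fun b => isCompatible_chiSplittingLine L e' dV hdV hdV0 (toHeckeCharacter L μ)
                (isUnitary_toHeckeCharacter L μ) ((isOscillatorChar_toHeckeCharacter_iff μ).mpr hμ)
                (TW (↥(maximalRealSubfield L)) b) (isSymm_TW (↥(maximalRealSubfield L)) b)
                (isUnit_det_TW (↥(maximalRealSubfield L)) b) (JW (↥(maximalRealSubfield L)) L b)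
                (JW_eq (↥(maximalRealSubfield L)) L b)) ιV a χ k w) =
            fun x => θ' w (x * finAdelicToAdelic (↥(maximalRealSubfield L)) L (IsCMField.complexConj L) N H k)) :
    ∃ θ : omegaAtLine (↥(maximalRealSubfield L)) L (IsCMField.complexConj L) N e (Matrix.diagonal dV)
          (complexConj_imagUnit L) (imagUnit_ne_zero L) (imagUnit_mul_self L) (realDiagonal_isSymm L dV hdV)
          (isUnit_det_realDiagonal L dV hdV hdV0) (realDiagonal_map L dV hdV).symm
          (fun b => isCompatible_chiSplittingLine L e dV hdV hdV0 (toHeckeCharacter L μ)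
            (isUnitary_toHeckeCharacter L μ) ((isOscillatorChar_toHeckeCharacter_iff μ).mpr hμ)
            (TW (↥(maximalRealSubfield L)) b) (isSymm_TW (↥(maximalRealSubfield L)) b)
            (isUnit_det_TW (↥(maximalRealSubfield L)) b) (JW (↥(maximalRealSubfield L)) L b)
            (JW_eq (↥(maximalRealSubfield L)) L b)) a χ →ₗ[ℂ]
        ((adelicGroupData (↥(maximalRealSubfield L)) L (IsCMField.complexConj L) N H).Adelic → (Fin 2 → ℂ)),
      θ ≠ 0 ∧ (∀ w, θ w ∈ A) ∧
        ∀ (k : finAdelic (↥(maximalRealSubfield L)) L (IsCMField.complexConj L) N H) (w),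
          θ (rhoAtLine (↥(maximalRealSubfield L)) L (IsCMField.complexConj L) N e (Matrix.diagonal dV)
              (complexConj_imagUnit L) (imagUnit_ne_zero L) (imagUnit_mul_self L) (realDiagonal_isSymm L dV hdV)
              (isUnit_det_realDiagonal L dV hdV hdV0) (realDiagonal_map L dV hdV).symm
              (fun b => isCompatible_chiSplittingLine L e dV hdV hdV0 (toHeckeCharacter L μ)
                (isUnitary_toHeckeCharacter L μ) ((isOscillatorChar_toHeckeCharacter_iff μ).mpr hμ)
                (TW (↥(maximalRealSubfield L)) b) (isSymm_TW (↥(maximalRealSubfield L)) b)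
                (isUnit_det_TW (↥(maximalRealSubfield L)) b) (JW (↥(maximalRealSubfield L)) L b)
                (JW_eq (↥(maximalRealSubfield L)) L b)) ιV a χ k w) =
            fun x => θ w (x * finAdelicToAdelic (↥(maximalRealSubfield L)) L (IsCMField.complexConj L) N H k) := by
  obtain ⟨θ', hne', hA', heqv'⟩ := h'
  obtain ⟨Ψ, -, hΨ⟩ := exists_omegaAtLine_equiv_rhoVAtLine_reindex L e e' dV hdV hdV0 (toHeckeCharacter L μ)
    (isUnitary_toHeckeCharacter L μ) ((isOscillatorChar_toHeckeCharacter_iff μ).mpr hμ) a χ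
  refine ⟨θ' ∘ₗ Ψ.toLinearMap, fun h0 => hne' ?_, fun w => hA' (Ψ w), fun k w => ?_⟩
  · -- `θ′ = (θ′ ∘ Ψ) ∘ Ψ⁻¹ = 0`
    refine LinearMap.ext fun w => ?_
    have := congrArg (fun f : _ →ₗ[ℂ] _ => f (Ψ.symm w)) h0
    simpa only [LinearMap.coe_comp, Function.comp_apply, LinearEquiv.coe_coe, LinearEquiv.apply_symm_apply,
      LinearMap.zero_apply] using this
  · -- equivariance: `ρ(a,χ)[e] k = ρ_V(a,χ)[e] (ιV k)` and `Ψ` intertwines `ρ_V[e]` with `ρ_V[e′]` on the nose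
    show θ' (Ψ (rhoVAtLine (↥(maximalRealSubfield L)) L (IsCMField.complexConj L) N e (Matrix.diagonal dV)
        (complexConj_imagUnit L) (imagUnit_ne_zero L) (imagUnit_mul_self L) (realDiagonal_isSymm L dV hdV)
        (isUnit_det_realDiagonal L dV hdV hdV0) (realDiagonal_map L dV hdV).symm
        (fun b => isCompatible_chiSplittingLine L e dV hdV hdV0 (toHeckeCharacter L μ)
          (isUnitary_toHeckeCharacter L μ) ((isOscillatorChar_toHeckeCharacter_iff μ).mpr hμ)
          (TW (↥(maximalRealSubfield L)) b) (isSymm_TW (↥(maximalRealSubfield L)) b)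
          (isUnit_det_TW (↥(maximalRealSubfield L)) b) (JW (↥(maximalRealSubfield L)) L b)
          (JW_eq (↥(maximalRealSubfield L)) L b)) a χ (ιV k) w)) =
      fun x => θ' (Ψ w) (x * finAdelicToAdelic (↥(maximalRealSubfield L)) L (IsCMField.complexConj L) N H k)
    rw [hΨ (ιV k) w]
    exact heqv' k (Ψ w)

end Reindex

/-! ## §2 Θ-OCC-GEN at every frame, ORIENTATION CASE A (`(mk ι).embedding = ι ∈ Φ_μ`), from the χN-GEN row of the engine -/

set_option synthInstance.maxHeartbeats 400000 in
set_option maxHeartbeats 8000000 in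
/-- **Θ-OCC-GEN — ORIENTATION CASE A — FROM χN-GEN** (see the module docstring).  Hypothesis `hX` = χN-GEN: the `(χ)`+`(N)` row of the model datum
(the hypothesis `hχN` of (i) ★ `F0P2sThetaOccursInEngineGen.exists_holTheta_atFrame_of_chiN` at the seesaw label `Φ := hμ.cmType`) at EVERY packaged
anisotropic CM frame `(F, V)` with `(mk ι₁).embedding = ι₁`, every conjugate-symplectic weight-one `μ` with `ι₁ ∈ Φ_μ`, every `χ` and every admissible
line `(e, a)`.  Conclusion = the body of `StubThetaOccursInGen` (`Cruxes/H413/Lines/F0_P2OccFlatGeneral.lean` :152–188) with the two ORIENTATION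
hypotheses `(InfinitePlace.mk ι).embedding = ι` and `ι ∈ hμ.cmType.1` inserted before its `∃ θ`-clause, everything else TOKEN FOR TOKEN.  Proof: ★ R3
(admissible representative `a′`), (An) from `2 ≤ [L⁺:ℚ]`, (i) at `(cmFieldOf L, hermSpace3Of L ι H T hT ‹hpos›, a′)`, ★ p844332 (Ta)∘(Tf), §1 (enumeration).
[cite: Liu2021, Prop. 4.13 («Conversely» l. 2145–2149); Def. 4.11–4.12; App. D §D.1 Steps 1–3, Lem. D.2] [cite: GelbartRogawski1991, §3.1 Prop. 3.1.1 p. 455; Remark p. 457 L4–13]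
[cite: KonnoKonno2007, Thm 5.4] -/
theorem thetaOccursInGen_caseA_of_chiN
    (hX : ∀ (F : HodgeCM.CMField) {ι₁ : F →+* ℂ} (V : HodgeCM.HermSpace3 F ι₁) (_hV : IsAnisotropic F (HodgeCM.HermSpace3.Hm V))
        (_hemb : (InfinitePlace.mk ι₁).embedding = ι₁)
        (μ : Literature.NumberTheory.Automorphic.IdeleClassGroup (HodgeCM.CMField.K F) →ₜ* Circle)
        (hμ : IdeleClassGroup.IsConjugateSymplectic (HodgeCM.CMField.K F) μ) (_hw : IdeleClassGroup.HasWeight (HodgeCM.CMField.K F) μ 1)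
        (_hι : ι₁ ∈ hμ.cmType.1)
        (χ : Chi ↥(maximalRealSubfield (HodgeCM.CMField.K F)) (HodgeCM.CMField.K F) (IsCMField.complexConj (HodgeCM.CMField.K F)))
        (e : HodgeCM.CMField.K F) (a : (↥(maximalRealSubfield (HodgeCM.CMField.K F)))ˣ)
        (_he : Literature.AlgebraicGeometry.Liu2021.IsAdmissibleElement (HodgeCM.CMField.K F) hμ.cmType.1 e)
        (_hae : ((a : ↥(maximalRealSubfield (HodgeCM.CMField.K F))) : HodgeCM.CMField.K F) = e * (2 * imagUnit (HodgeCM.CMField.K F))),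
      ∀ (hV : IsAnisotropic F (HodgeCM.HermSpace3.Hm V)) (ha : IsCMField.complexConj (HodgeCM.CMField.K F) ((a : ↥(maximalRealSubfield (HodgeCM.CMField.K F))) : (HodgeCM.CMField.K F)) = ((a : ↥(maximalRealSubfield (HodgeCM.CMField.K F))) : (HodgeCM.CMField.K F))) (ha0 : ((a : ↥(maximalRealSubfield (HodgeCM.CMField.K F))) :
        (HodgeCM.CMField.K F)) ≠ 0)
      (hpos : 0 < cmXW (HodgeCM.CMField.K F) (frameD V) (lineVec (HodgeCM.CMField.K F) (dW (cDiag hμ.cmType ι₁ ((a : ↥(maximalRealSubfield (HodgeCM.CMField.K F))) : (HodgeCM.CMField.K F)) ha ha0).D 0)) (fun _ => dW_real (cDiag hμ.cmType ι₁ ((a : ↥(maximalRealSubfield (HodgeCM.CMField.K F))) : (HodgeCM.CMField.K F)) ha ha0).D 0) ι₁ (cmPlace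
          (HodgeCM.CMField.K F) ι₁) 0)
      (ĉ : UnitaryGroup.adelicPair (↥(maximalRealSubfield (HodgeCM.CMField.K F))) (HodgeCM.CMField.K F) (IsCMField.complexConj (HodgeCM.CMField.K F)) 3 1
        (Matrix.diagonal (frameD V)) (Matrix.diagonal (lineVec (HodgeCM.CMField.K F) ((a : ↥(maximalRealSubfield (HodgeCM.CMField.K F))) : (HodgeCM.CMField.K F)))) →* ℂˣ),
      (chiSplitting (HodgeCM.CMField.K F) e₁ (frameD V) (frameD_real V) (frameD_ne V) (lineVec (HodgeCM.CMField.K F) ((a : ↥(maximalRealSubfield (HodgeCM.CMField.K F))) : (HodgeCM.CMField.K F))) (complexConj_lineVec_coe (HodgeCM.CMField.K F) a) (lineVec_coe_ne_zero (HodgeCM.CMField.K F) a)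
          (Literature.NumberTheory.Automorphic.IdeleClassGroup.toHeckeCharacter (HodgeCM.CMField.K F) μ) (Literature.NumberTheory.Automorphic.IdeleClassGroup.isUnitary_toHeckeCharacter (HodgeCM.CMField.K F) μ) ((Literature.RepresentationTheory.Liu2021.isOscillatorChar_toHeckeCharacter_iff μ).mpr hμ)) =
        adelicMpCont.twist (↥(maximalRealSubfield (HodgeCM.CMField.K F))) (Fin 3) _ (splittingOf _ _ _ _ _ _ _ _ _ _ _ _ _ _ _ _ _ (compat_line₀ V hμ.cmType ι₁ ((a : ↥(maximalRealSubfield (HodgeCM.CMField.K F))) : (HodgeCM.CMField.K F)) ha ha0)) ĉ →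
      (∀ γU ∈ (UnitaryGroup.toAdelic (↥(maximalRealSubfield (HodgeCM.CMField.K F))) (HodgeCM.CMField.K F) (IsCMField.complexConj (HodgeCM.CMField.K F)) 3 (Matrix.diagonal (frameD V))).range, ĉ ((UnitaryGroup.adelicInl (↥(maximalRealSubfield (HodgeCM.CMField.K F))) (HodgeCM.CMField.K F) (IsCMField.complexConj (HodgeCM.CMField.K
          F)) 3 1 (Matrix.diagonal (frameD V)) (Matrix.diagonal (lineVec (HodgeCM.CMField.K F) ((a : ↥(maximalRealSubfield (HodgeCM.CMField.K F))) : (HodgeCM.CMField.K F))))) γU) = 1) →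
      (∀ γ ∈ (UnitaryGroup.toAdelic (↥(maximalRealSubfield (HodgeCM.CMField.K F))) (HodgeCM.CMField.K F) (IsCMField.complexConj (HodgeCM.CMField.K F)) 1 (Matrix.diagonal (lineVec (HodgeCM.CMField.K F) ((a : ↥(maximalRealSubfield (HodgeCM.CMField.K F))) : (HodgeCM.CMField.K F))))).range, ĉ ((UnitaryGroup.adelicInr
          (↥(maximalRealSubfield (HodgeCM.CMField.K F))) (HodgeCM.CMField.K F) (IsCMField.complexConj (HodgeCM.CMField.K F)) 3 1 (Matrix.diagonal (frameD V)) (Matrix.diagonal (lineVec (HodgeCM.CMField.K F) ((a : ↥(maximalRealSubfield (HodgeCM.CMField.K F))) : (HodgeCM.CMField.K F))))) γ) = 1) →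
      Continuous ĉ →
      ∀ (hν : ∀ γU ∈ CMRat (HodgeCM.CMField.K F) (frameD V), ((cmLineChar₀ (HodgeCM.CMField.K F) finProdFinEquiv e₁ (frameD V) (frameD_real V) (frameD_ne V) (dW (cDiag hμ.cmType ι₁ ((a : ↥(maximalRealSubfield (HodgeCM.CMField.K F))) : (HodgeCM.CMField.K F)) ha ha0).D) (dW_real (cDiag hμ.cmType ι₁ ((a : ↥(maximalRealSubfield (HodgeCM.CMField.K
          F))) : (HodgeCM.CMField.K F)) ha ha0).D) (dW_ne (cDiag hμ.cmType ι₁ ((a : ↥(maximalRealSubfield (HodgeCM.CMField.K F))) : (HodgeCM.CMField.K F)) ha ha0).D) (compat_plane V hμ.cmType ι₁ ((a : ↥(maximalRealSubfield (HodgeCM.CMField.K F))) : (HodgeCM.CMField.K F)) ha ha0) (compat_line₀ V hμ.cmType ι₁ ((a : ↥(maximalRealSubfield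
          (HodgeCM.CMField.K F))) : (HodgeCM.CMField.K F)) ha ha0) (compat_line₁ V hμ.cmType ι₁ ((a : ↥(maximalRealSubfield (HodgeCM.CMField.K F))) : (HodgeCM.CMField.K F)) ha ha0)).comp (MonoidHom.inl _ _) * (ĉ.comp (UnitaryGroup.adelicInl (↥(maximalRealSubfield (HodgeCM.CMField.K F))) (HodgeCM.CMField.K F) (IsCMField.complexConj
          (HodgeCM.CMField.K F)) 3 1 (Matrix.diagonal (frameD V)) (Matrix.diagonal (lineVec (HodgeCM.CMField.K F) ((a : ↥(maximalRealSubfield (HodgeCM.CMField.K F))) : (HodgeCM.CMField.K F))))))⁻¹) γU = 1)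
        (hνc : Continuous fun v => ((((cmLineChar₀ (HodgeCM.CMField.K F) finProdFinEquiv e₁ (frameD V) (frameD_real V) (frameD_ne V) (dW (cDiag hμ.cmType ι₁ ((a : ↥(maximalRealSubfield (HodgeCM.CMField.K F))) : (HodgeCM.CMField.K F)) ha ha0).D) (dW_real (cDiag hμ.cmType ι₁ ((a : ↥(maximalRealSubfield (HodgeCM.CMField.K F))) :
            (HodgeCM.CMField.K F)) ha ha0).D) (dW_ne (cDiag hμ.cmType ι₁ ((a : ↥(maximalRealSubfield (HodgeCM.CMField.K F))) : (HodgeCM.CMField.K F)) ha ha0).D) (compat_plane V hμ.cmType ι₁ ((a : ↥(maximalRealSubfield (HodgeCM.CMField.K F))) : (HodgeCM.CMField.K F)) ha ha0) (compat_line₀ V hμ.cmType ι₁ ((a : ↥(maximalRealSubfield (HodgeCM.CMField.K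
            F))) : (HodgeCM.CMField.K F)) ha ha0) (compat_line₁ V hμ.cmType ι₁ ((a : ↥(maximalRealSubfield (HodgeCM.CMField.K F))) : (HodgeCM.CMField.K F)) ha ha0)).comp (MonoidHom.inl _ _) * (ĉ.comp (UnitaryGroup.adelicInl (↥(maximalRealSubfield (HodgeCM.CMField.K F))) (HodgeCM.CMField.K F) (IsCMField.complexConj (HodgeCM.CMField.K
            F)) 3 1 (Matrix.diagonal (frameD V)) (Matrix.diagonal (lineVec (HodgeCM.CMField.K F) ((a : ↥(maximalRealSubfield (HodgeCM.CMField.K F))) : (HodgeCM.CMField.K F))))))⁻¹) v : ℂˣ) : ℂ))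
        (A : ∀ k : Fin 4, ArchLineInput V (lineRepT V (cDiag hμ.cmType ι₁ ((a : ↥(maximalRealSubfield (HodgeCM.CMField.K F))) : (HodgeCM.CMField.K F)) ha ha0).D (compat_plane V hμ.cmType ι₁ ((a : ↥(maximalRealSubfield (HodgeCM.CMField.K F))) : (HodgeCM.CMField.K F)) ha ha0) (compat_line₀ V hμ.cmType ι₁ ((a : ↥(maximalRealSubfield (HodgeCM.CMField.K
            F))) : (HodgeCM.CMField.K F)) ha ha0) (compat_line₁ V hμ.cmType ι₁ ((a : ↥(maximalRealSubfield (HodgeCM.CMField.K F))) : (HodgeCM.CMField.K F)) ha ha0) (compat_line₂ V hμ.cmType ι₁ ((a : ↥(maximalRealSubfield (HodgeCM.CMField.K F))) : (HodgeCM.CMField.K F)) ha ha0) (compat_line₃ V hμ.cmType ι₁ ((a : ↥(maximalRealSubfield (HodgeCM.CMField.K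
            F))) : (HodgeCM.CMField.K F)) ha ha0) (1 : CMAdelic (HodgeCM.CMField.K F) (frameD V) × CMAdelic (HodgeCM.CMField.K F) (dW (cDiag hμ.cmType ι₁ ((a : ↥(maximalRealSubfield (HodgeCM.CMField.K F))) : (HodgeCM.CMField.K F)) ha ha0).D) →* ℂˣ) ((cmLineChar₀ (HodgeCM.CMField.K F) finProdFinEquiv e₁ (frameD V) (frameD_real V)
            (frameD_ne V) (dW (cDiag hμ.cmType ι₁ ((a : ↥(maximalRealSubfield (HodgeCM.CMField.K F))) : (HodgeCM.CMField.K F)) ha ha0).D) (dW_real (cDiag hμ.cmType ι₁ ((a : ↥(maximalRealSubfield (HodgeCM.CMField.K F))) : (HodgeCM.CMField.K F)) ha ha0).D) (dW_ne (cDiag hμ.cmType ι₁ ((a : ↥(maximalRealSubfield (HodgeCM.CMField.K F))) :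
            (HodgeCM.CMField.K F)) ha ha0).D) (compat_plane V hμ.cmType ι₁ ((a : ↥(maximalRealSubfield (HodgeCM.CMField.K F))) : (HodgeCM.CMField.K F)) ha ha0) (compat_line₀ V hμ.cmType ι₁ ((a : ↥(maximalRealSubfield (HodgeCM.CMField.K F))) : (HodgeCM.CMField.K F)) ha ha0) (compat_line₁ V hμ.cmType ι₁ ((a : ↥(maximalRealSubfield (HodgeCM.CMField.K
            F))) : (HodgeCM.CMField.K F)) ha ha0)).comp (MonoidHom.inl _ _) * (ĉ.comp (UnitaryGroup.adelicInl (↥(maximalRealSubfield (HodgeCM.CMField.K F))) (HodgeCM.CMField.K F) (IsCMField.complexConj (HodgeCM.CMField.K F)) 3 1 (Matrix.diagonal (frameD V)) (Matrix.diagonal (lineVec (HodgeCM.CMField.K F) ((a :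
            ↥(maximalRealSubfield (HodgeCM.CMField.K F))) : (HodgeCM.CMField.K F))))))⁻¹) k))
        (harm : ∀ (u : ↥(stabilizer U21 x₀)) (ℓ : Module.Dual ℂ (Fin 2 → ℂ)),
          lineOmega_zero V (cDiag hμ.cmType ι₁ ((a : ↥(maximalRealSubfield (HodgeCM.CMField.K F))) : (HodgeCM.CMField.K F)) ha ha0).D (compat_plane V hμ.cmType ι₁ ((a : ↥(maximalRealSubfield (HodgeCM.CMField.K F))) : (HodgeCM.CMField.K F)) ha ha0) (compat_line₀ V hμ.cmType ι₁ ((a : ↥(maximalRealSubfield (HodgeCM.CMField.K F))) : (HodgeCM.CMField.K F))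
              ha ha0) (compat_line₁ V hμ.cmType ι₁ ((a : ↥(maximalRealSubfield (HodgeCM.CMField.K F))) : (HodgeCM.CMField.K F)) ha ha0) (etaT₀ V (cDiag hμ.cmType ι₁ ((a : ↥(maximalRealSubfield (HodgeCM.CMField.K F))) : (HodgeCM.CMField.K F)) ha ha0).D (1 : CMAdelic (HodgeCM.CMField.K F) (frameD V) × CMAdelic (HodgeCM.CMField.K F) (dW (cDiag hμ.cmType
              ι₁ ((a : ↥(maximalRealSubfield (HodgeCM.CMField.K F))) : (HodgeCM.CMField.K F)) ha ha0).D) →* ℂˣ) ((cmLineChar₀ (HodgeCM.CMField.K F) finProdFinEquiv e₁ (frameD V) (frameD_real V) (frameD_ne V) (dW (cDiag hμ.cmType ι₁ ((a : ↥(maximalRealSubfield (HodgeCM.CMField.K F))) : (HodgeCM.CMField.K F)) ha ha0).D) (dW_real (cDiag hμ.cmType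
              ι₁ ((a : ↥(maximalRealSubfield (HodgeCM.CMField.K F))) : (HodgeCM.CMField.K F)) ha ha0).D) (dW_ne (cDiag hμ.cmType ι₁ ((a : ↥(maximalRealSubfield (HodgeCM.CMField.K F))) : (HodgeCM.CMField.K F)) ha ha0).D) (compat_plane V hμ.cmType ι₁ ((a : ↥(maximalRealSubfield (HodgeCM.CMField.K F))) : (HodgeCM.CMField.K F)) ha ha0)
              (compat_line₀ V hμ.cmType ι₁ ((a : ↥(maximalRealSubfield (HodgeCM.CMField.K F))) : (HodgeCM.CMField.K F)) ha ha0) (compat_line₁ V hμ.cmType ι₁ ((a : ↥(maximalRealSubfield (HodgeCM.CMField.K F))) : (HodgeCM.CMField.K F)) ha ha0)).comp (MonoidHom.inl _ _) * (ĉ.comp (UnitaryGroup.adelicInl (↥(maximalRealSubfield (HodgeCM.CMField.K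
              F))) (HodgeCM.CMField.K F) (IsCMField.complexConj (HodgeCM.CMField.K F)) 3 1 (Matrix.diagonal (frameD V)) (Matrix.diagonal (lineVec (HodgeCM.CMField.K F) ((a : ↥(maximalRealSubfield (HodgeCM.CMField.K F))) : (HodgeCM.CMField.K F))))))⁻¹)) (u : U21) ((blockFamilyOfAt (HodgeCM.CMField.K F) e₁ (frameD V) (frameD_real
              V) (frameD_ne V) (lineVec (HodgeCM.CMField.K F) (dW (cDiag hμ.cmType ι₁ ((a : ↥(maximalRealSubfield (HodgeCM.CMField.K F))) : (HodgeCM.CMField.K F)) ha ha0).D 0)) (fun _ => dW_real (cDiag hμ.cmType ι₁ ((a : ↥(maximalRealSubfield (HodgeCM.CMField.K F))) : (HodgeCM.CMField.K F)) ha ha0).D 0) (fun _ => dW_ne (cDiag hμ.cmType ι₁ ((a :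
              ↥(maximalRealSubfield (HodgeCM.CMField.K F))) : (HodgeCM.CMField.K F)) ha ha0).D 0) ι₁ (blockPosEquiv V) (blockNegEquiv V) (posIdxEquivUnit hpos) (negIdxEquivEmpty hpos) (degOnePDual Empty) (binvPi 1)) ℓ) =
            (blockFamilyOfAt (HodgeCM.CMField.K F) e₁ (frameD V) (frameD_real V) (frameD_ne V) (lineVec (HodgeCM.CMField.K F) (dW (cDiag hμ.cmType ι₁ ((a : ↥(maximalRealSubfield (HodgeCM.CMField.K F))) : (HodgeCM.CMField.K F)) ha ha0).D 0)) (fun _ => dW_real (cDiag hμ.cmType ι₁ ((a : ↥(maximalRealSubfield (HodgeCM.CMField.K F))) :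
                (HodgeCM.CMField.K F)) ha ha0).D 0) (fun _ => dW_ne (cDiag hμ.cmType ι₁ ((a : ↥(maximalRealSubfield (HodgeCM.CMField.K F))) : (HodgeCM.CMField.K F)) ha ha0).D 0) ι₁ (blockPosEquiv V) (blockNegEquiv V) (posIdxEquivUnit hpos) (negIdxEquivEmpty hpos) (degOnePDual Empty) (binvPi 1))
                ((BallForms.isPullbackCocycle_cotangentCocycle.weightOf x₀).dual u ℓ))
        (hdef : ∀ g : UnitaryGroup.arch (↥(maximalRealSubfield (HodgeCM.CMField.K F))) (HodgeCM.CMField.K F) (IsCMField.complexConj (HodgeCM.CMField.K F)) 3 V.Hm,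
          UnitaryGroup.archAt (↥(maximalRealSubfield (HodgeCM.CMField.K F))) (HodgeCM.CMField.K F) (IsCMField.complexConj (HodgeCM.CMField.K F)) 3 V.Hm (UnitaryGroup.cmPlace (HodgeCM.CMField.K F) ι₁) (NumberField.complexConj_smul_infinitePlace (HodgeCM.CMField.K F) _) (IsCMField.complexConj_ne_one (HodgeCM.CMField.K F)) g = 1 →
          ∀ (ℓ : Module.Dual ℂ (Fin 2 → ℂ)) (Φf : FinSB (↥(maximalRealSubfield (HodgeCM.CMField.K F))) (Fin 3)),
            lineRepOf V (cDiag hμ.cmType ι₁ ((a : ↥(maximalRealSubfield (HodgeCM.CMField.K F))) : (HodgeCM.CMField.K F)) ha ha0).D (compat_plane V hμ.cmType ι₁ ((a : ↥(maximalRealSubfield (HodgeCM.CMField.K F))) : (HodgeCM.CMField.K F)) ha ha0) (compat_line₀ V hμ.cmType ι₁ ((a : ↥(maximalRealSubfield (HodgeCM.CMField.K F))) : (HodgeCM.CMField.K F)) ha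
                ha0) (compat_line₁ V hμ.cmType ι₁ ((a : ↥(maximalRealSubfield (HodgeCM.CMField.K F))) : (HodgeCM.CMField.K F)) ha ha0) (compat_line₂ V hμ.cmType ι₁ ((a : ↥(maximalRealSubfield (HodgeCM.CMField.K F))) : (HodgeCM.CMField.K F)) ha ha0) (compat_line₃ V hμ.cmType ι₁ ((a : ↥(maximalRealSubfield (HodgeCM.CMField.K F))) : (HodgeCM.CMField.K
                F)) ha ha0) (etaT₀ V (cDiag hμ.cmType ι₁ ((a : ↥(maximalRealSubfield (HodgeCM.CMField.K F))) : (HodgeCM.CMField.K F)) ha ha0).D (1 : CMAdelic (HodgeCM.CMField.K F) (frameD V) × CMAdelic (HodgeCM.CMField.K F) (dW (cDiag hμ.cmType ι₁ ((a : ↥(maximalRealSubfield (HodgeCM.CMField.K F))) : (HodgeCM.CMField.K F)) ha ha0).D) →* ℂˣ)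
                ((cmLineChar₀ (HodgeCM.CMField.K F) finProdFinEquiv e₁ (frameD V) (frameD_real V) (frameD_ne V) (dW (cDiag hμ.cmType ι₁ ((a : ↥(maximalRealSubfield (HodgeCM.CMField.K F))) : (HodgeCM.CMField.K F)) ha ha0).D) (dW_real (cDiag hμ.cmType ι₁ ((a : ↥(maximalRealSubfield (HodgeCM.CMField.K F))) : (HodgeCM.CMField.K F)) ha ha0).D)
                (dW_ne (cDiag hμ.cmType ι₁ ((a : ↥(maximalRealSubfield (HodgeCM.CMField.K F))) : (HodgeCM.CMField.K F)) ha ha0).D) (compat_plane V hμ.cmType ι₁ ((a : ↥(maximalRealSubfield (HodgeCM.CMField.K F))) : (HodgeCM.CMField.K F)) ha ha0) (compat_line₀ V hμ.cmType ι₁ ((a : ↥(maximalRealSubfield (HodgeCM.CMField.K F))) : (HodgeCM.CMField.K F)) ha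
                ha0) (compat_line₁ V hμ.cmType ι₁ ((a : ↥(maximalRealSubfield (HodgeCM.CMField.K F))) : (HodgeCM.CMField.K F)) ha ha0)).comp (MonoidHom.inl _ _) * (ĉ.comp (UnitaryGroup.adelicInl (↥(maximalRealSubfield (HodgeCM.CMField.K F))) (HodgeCM.CMField.K F) (IsCMField.complexConj (HodgeCM.CMField.K F)) 3 1 (Matrix.diagonal
                (frameD V)) (Matrix.diagonal (lineVec (HodgeCM.CMField.K F) ((a : ↥(maximalRealSubfield (HodgeCM.CMField.K F))) : (HodgeCM.CMField.K F))))))⁻¹))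
                (etaT₁ V (cDiag hμ.cmType ι₁ ((a : ↥(maximalRealSubfield (HodgeCM.CMField.K F))) : (HodgeCM.CMField.K F)) ha ha0).D (1 : CMAdelic (HodgeCM.CMField.K F) (frameD V) × CMAdelic (HodgeCM.CMField.K F) (dW (cDiag hμ.cmType ι₁ ((a : ↥(maximalRealSubfield (HodgeCM.CMField.K F))) : (HodgeCM.CMField.K F)) ha ha0).D) →* ℂˣ) ((cmLineChar₀
                    (HodgeCM.CMField.K F) finProdFinEquiv e₁ (frameD V) (frameD_real V) (frameD_ne V) (dW (cDiag hμ.cmType ι₁ ((a : ↥(maximalRealSubfield (HodgeCM.CMField.K F))) : (HodgeCM.CMField.K F)) ha ha0).D) (dW_real (cDiag hμ.cmType ι₁ ((a : ↥(maximalRealSubfield (HodgeCM.CMField.K F))) : (HodgeCM.CMField.K F)) ha ha0).D) (dW_ne (cDiag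
                    hμ.cmType ι₁ ((a : ↥(maximalRealSubfield (HodgeCM.CMField.K F))) : (HodgeCM.CMField.K F)) ha ha0).D) (compat_plane V hμ.cmType ι₁ ((a : ↥(maximalRealSubfield (HodgeCM.CMField.K F))) : (HodgeCM.CMField.K F)) ha ha0) (compat_line₀ V hμ.cmType ι₁ ((a : ↥(maximalRealSubfield (HodgeCM.CMField.K F))) : (HodgeCM.CMField.K F)) ha ha0)
                    (compat_line₁ V hμ.cmType ι₁ ((a : ↥(maximalRealSubfield (HodgeCM.CMField.K F))) : (HodgeCM.CMField.K F)) ha ha0)).comp (MonoidHom.inl _ _) * (ĉ.comp (UnitaryGroup.adelicInl (↥(maximalRealSubfield (HodgeCM.CMField.K F))) (HodgeCM.CMField.K F) (IsCMField.complexConj (HodgeCM.CMField.K F)) 3 1 (Matrix.diagonal (frameD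
                    V)) (Matrix.diagonal (lineVec (HodgeCM.CMField.K F) ((a : ↥(maximalRealSubfield (HodgeCM.CMField.K F))) : (HodgeCM.CMField.K F))))))⁻¹)) (eta₂ V (cDiag hμ.cmType ι₁ ((a : ↥(maximalRealSubfield (HodgeCM.CMField.K F))) : (HodgeCM.CMField.K F)) ha ha0).D (1 : CMAdelic (HodgeCM.CMField.K F) (frameD V) × CMAdelic
                    (HodgeCM.CMField.K F) (dW (cDiag hμ.cmType ι₁ ((a : ↥(maximalRealSubfield (HodgeCM.CMField.K F))) : (HodgeCM.CMField.K F)) ha ha0).D) →* ℂˣ)) (eta₃ V (cDiag hμ.cmType ι₁ ((a : ↥(maximalRealSubfield (HodgeCM.CMField.K F))) : (HodgeCM.CMField.K F)) ha ha0).D (1 : CMAdelic (HodgeCM.CMField.K F) (frameD V) × CMAdelic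
                    (HodgeCM.CMField.K F) (dW (cDiag hμ.cmType ι₁ ((a : ↥(maximalRealSubfield (HodgeCM.CMField.K F))) : (HodgeCM.CMField.K F)) ha ha0).D) →* ℂˣ)) 0
                (HodgeCM.Adelic.regimeEquiv F V.Hm hV (UnitaryGroup.archToAdelic (↥(maximalRealSubfield (HodgeCM.CMField.K F))) (HodgeCM.CMField.K F) (IsCMField.complexConj (HodgeCM.CMField.K F)) 3 V.Hm g), 1)
                (piSchwartzBruhatEquiv (↥(maximalRealSubfield (HodgeCM.CMField.K F))) (Fin 3) ((blockFamilyOfAt (HodgeCM.CMField.K F) e₁ (frameD V) (frameD_real V) (frameD_ne V) (lineVec (HodgeCM.CMField.K F) (dW (cDiag hμ.cmType ι₁ ((a : ↥(maximalRealSubfield (HodgeCM.CMField.K F))) : (HodgeCM.CMField.K F)) ha ha0).D 0)) (fun _ =>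
                    dW_real (cDiag hμ.cmType ι₁ ((a : ↥(maximalRealSubfield (HodgeCM.CMField.K F))) : (HodgeCM.CMField.K F)) ha ha0).D 0) (fun _ => dW_ne (cDiag hμ.cmType ι₁ ((a : ↥(maximalRealSubfield (HodgeCM.CMField.K F))) : (HodgeCM.CMField.K F)) ha ha0).D 0) ι₁ (blockPosEquiv V) (blockNegEquiv V) (posIdxEquivUnit hpos) (negIdxEquivEmpty
                    hpos) (degOnePDual Empty) (binvPi 1)) ℓ ⊗ₜ[ℂ] Φf)) =
              piSchwartzBruhatEquiv (↥(maximalRealSubfield (HodgeCM.CMField.K F))) (Fin 3) ((blockFamilyOfAt (HodgeCM.CMField.K F) e₁ (frameD V) (frameD_real V) (frameD_ne V) (lineVec (HodgeCM.CMField.K F) (dW (cDiag hμ.cmType ι₁ ((a : ↥(maximalRealSubfield (HodgeCM.CMField.K F))) : (HodgeCM.CMField.K F)) ha ha0).D 0)) (fun _ =>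
                  dW_real (cDiag hμ.cmType ι₁ ((a : ↥(maximalRealSubfield (HodgeCM.CMField.K F))) : (HodgeCM.CMField.K F)) ha ha0).D 0) (fun _ => dW_ne (cDiag hμ.cmType ι₁ ((a : ↥(maximalRealSubfield (HodgeCM.CMField.K F))) : (HodgeCM.CMField.K F)) ha ha0).D 0) ι₁ (blockPosEquiv V) (blockNegEquiv V) (posIdxEquivUnit hpos) (negIdxEquivEmpty
                  hpos) (degOnePDual Empty) (binvPi 1)) ℓ ⊗ₜ[ℂ] Φf)),
      ∃ χM : PontryaginDual (↥(Literature.NumberTheory.Automorphic.relNormOneIdeles (↥(maximalRealSubfield (HodgeCM.CMField.K F))) (HodgeCM.CMField.K F)) ⧸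
          Literature.NumberTheory.Automorphic.relNormOneRat (↥(maximalRealSubfield (HodgeCM.CMField.K F))) (HodgeCM.CMField.K F)),
        (∀ u : UfZero (cDiag hμ.cmType ι₁ ((a : ↥(maximalRealSubfield (HodgeCM.CMField.K F))) : (HodgeCM.CMField.K F)) ha ha0).D,
          (distDatumAt V hμ.cmType ι₁ ((a : ↥(maximalRealSubfield (HodgeCM.CMField.K F))) : (HodgeCM.CMField.K F)) ha ha0 (1 : CMAdelic (HodgeCM.CMField.K F) (frameD V) × CMAdelic (HodgeCM.CMField.K F) (dW (cDiag hμ.cmType ι₁ ((a : ↥(maximalRealSubfield (HodgeCM.CMField.K F))) : (HodgeCM.CMField.K F)) ha ha0).D) →* ℂˣ) (one_apply_rat_eq_one V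
              (cDiag hμ.cmType ι₁ ((a : ↥(maximalRealSubfield (HodgeCM.CMField.K F))) : (HodgeCM.CMField.K F)) ha ha0)) (continuous_one_val V (cDiag hμ.cmType ι₁ ((a : ↥(maximalRealSubfield (HodgeCM.CMField.K F))) : (HodgeCM.CMField.K F)) ha ha0)) ((cmLineChar₀ (HodgeCM.CMField.K F) finProdFinEquiv e₁ (frameD V) (frameD_real V) (frameD_ne V)
              (dW (cDiag hμ.cmType ι₁ ((a : ↥(maximalRealSubfield (HodgeCM.CMField.K F))) : (HodgeCM.CMField.K F)) ha ha0).D) (dW_real (cDiag hμ.cmType ι₁ ((a : ↥(maximalRealSubfield (HodgeCM.CMField.K F))) : (HodgeCM.CMField.K F)) ha ha0).D) (dW_ne (cDiag hμ.cmType ι₁ ((a : ↥(maximalRealSubfield (HodgeCM.CMField.K F))) : (HodgeCM.CMField.K F)) ha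
              ha0).D) (compat_plane V hμ.cmType ι₁ ((a : ↥(maximalRealSubfield (HodgeCM.CMField.K F))) : (HodgeCM.CMField.K F)) ha ha0) (compat_line₀ V hμ.cmType ι₁ ((a : ↥(maximalRealSubfield (HodgeCM.CMField.K F))) : (HodgeCM.CMField.K F)) ha ha0) (compat_line₁ V hμ.cmType ι₁ ((a : ↥(maximalRealSubfield (HodgeCM.CMField.K F))) : (HodgeCM.CMField.K
              F)) ha ha0)).comp (MonoidHom.inl _ _) * (ĉ.comp (UnitaryGroup.adelicInl (↥(maximalRealSubfield (HodgeCM.CMField.K F))) (HodgeCM.CMField.K F) (IsCMField.complexConj (HodgeCM.CMField.K F)) 3 1 (Matrix.diagonal (frameD V)) (Matrix.diagonal (lineVec (HodgeCM.CMField.K F) ((a : ↥(maximalRealSubfield (HodgeCM.CMField.K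
              F))) : (HodgeCM.CMField.K F))))))⁻¹) hν hνc A hV (blockFamilyOfAt (HodgeCM.CMField.K F) e₁ (frameD V) (frameD_real V) (frameD_ne V) (lineVec (HodgeCM.CMField.K F) (dW (cDiag hμ.cmType ι₁ ((a : ↥(maximalRealSubfield (HodgeCM.CMField.K F))) : (HodgeCM.CMField.K F)) ha ha0).D 0)) (fun _ => dW_real (cDiag hμ.cmType ι₁ ((a :
              ↥(maximalRealSubfield (HodgeCM.CMField.K F))) : (HodgeCM.CMField.K F)) ha ha0).D 0) (fun _ => dW_ne (cDiag hμ.cmType ι₁ ((a : ↥(maximalRealSubfield (HodgeCM.CMField.K F))) : (HodgeCM.CMField.K F)) ha ha0).D 0) ι₁ (blockPosEquiv V) (blockNegEquiv V) (posIdxEquivUnit hpos) (negIdxEquivEmpty hpos) (degOnePDual Empty) (binvPi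
              1)) harm hdef).chiFin χM u = finCharZero V (cDiag hμ.cmType ι₁ ((a : ↥(maximalRealSubfield (HodgeCM.CMField.K F))) : (HodgeCM.CMField.K F)) ha ha0).D (compat_plane V hμ.cmType ι₁ ((a : ↥(maximalRealSubfield (HodgeCM.CMField.K F))) : (HodgeCM.CMField.K F)) ha ha0) (compat_line₀ V hμ.cmType ι₁ ((a : ↥(maximalRealSubfield (HodgeCM.CMField.K
              F))) : (HodgeCM.CMField.K F)) ha ha0) (compat_line₁ V hμ.cmType ι₁ ((a : ↥(maximalRealSubfield (HodgeCM.CMField.K F))) : (HodgeCM.CMField.K F)) ha ha0) (etaT₀ V (cDiag hμ.cmType ι₁ ((a : ↥(maximalRealSubfield (HodgeCM.CMField.K F))) : (HodgeCM.CMField.K F)) ha ha0).D (1 : CMAdelic (HodgeCM.CMField.K F) (frameD V) × CMAdelic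
              (HodgeCM.CMField.K F) (dW (cDiag hμ.cmType ι₁ ((a : ↥(maximalRealSubfield (HodgeCM.CMField.K F))) : (HodgeCM.CMField.K F)) ha ha0).D) →* ℂˣ) ((cmLineChar₀ (HodgeCM.CMField.K F) finProdFinEquiv e₁ (frameD V) (frameD_real V) (frameD_ne V) (dW (cDiag hμ.cmType ι₁ ((a : ↥(maximalRealSubfield (HodgeCM.CMField.K F))) :
              (HodgeCM.CMField.K F)) ha ha0).D) (dW_real (cDiag hμ.cmType ι₁ ((a : ↥(maximalRealSubfield (HodgeCM.CMField.K F))) : (HodgeCM.CMField.K F)) ha ha0).D) (dW_ne (cDiag hμ.cmType ι₁ ((a : ↥(maximalRealSubfield (HodgeCM.CMField.K F))) : (HodgeCM.CMField.K F)) ha ha0).D) (compat_plane V hμ.cmType ι₁ ((a : ↥(maximalRealSubfield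
              (HodgeCM.CMField.K F))) : (HodgeCM.CMField.K F)) ha ha0) (compat_line₀ V hμ.cmType ι₁ ((a : ↥(maximalRealSubfield (HodgeCM.CMField.K F))) : (HodgeCM.CMField.K F)) ha ha0) (compat_line₁ V hμ.cmType ι₁ ((a : ↥(maximalRealSubfield (HodgeCM.CMField.K F))) : (HodgeCM.CMField.K F)) ha ha0)).comp (MonoidHom.inl _ _) * (ĉ.comp
              (UnitaryGroup.adelicInl (↥(maximalRealSubfield (HodgeCM.CMField.K F))) (HodgeCM.CMField.K F) (IsCMField.complexConj (HodgeCM.CMField.K F)) 3 1 (Matrix.diagonal (frameD V)) (Matrix.diagonal (lineVec (HodgeCM.CMField.K F) ((a : ↥(maximalRealSubfield (HodgeCM.CMField.K F))) : (HodgeCM.CMField.K F))))))⁻¹)) (1, u) *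
              (((ĉ.comp ((MonoidHom.noncommCoprod (UnitaryGroup.adelicInl (↥(maximalRealSubfield (HodgeCM.CMField.K F))) (HodgeCM.CMField.K F) (IsCMField.complexConj (HodgeCM.CMField.K F)) 3 1 (Matrix.diagonal (frameD V)) (Matrix.diagonal (lineVec (HodgeCM.CMField.K F) ((a : ↥(maximalRealSubfield (HodgeCM.CMField.K F))) :
              (HodgeCM.CMField.K F))))) (UnitaryGroup.adelicInr (↥(maximalRealSubfield (HodgeCM.CMField.K F))) (HodgeCM.CMField.K F) (IsCMField.complexConj (HodgeCM.CMField.K F)) 3 1 (Matrix.diagonal (frameD V)) (Matrix.diagonal (lineVec (HodgeCM.CMField.K F) ((a : ↥(maximalRealSubfield (HodgeCM.CMField.K F))) :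
              (HodgeCM.CMField.K F))))) (UnitaryGroup.commute_adelicInl_adelicInr (↥(maximalRealSubfield (HodgeCM.CMField.K F))) (HodgeCM.CMField.K F) (IsCMField.complexConj (HodgeCM.CMField.K F)) 3 1 (Matrix.diagonal (frameD V)) (Matrix.diagonal (lineVec (HodgeCM.CMField.K F) ((a : ↥(maximalRealSubfield (HodgeCM.CMField.K F)))
              : (HodgeCM.CMField.K F)))))).comp (finPairToAdelic (↥(maximalRealSubfield (HodgeCM.CMField.K F))) (HodgeCM.CMField.K F) (IsCMField.complexConj (HodgeCM.CMField.K F)) 3 1 (Matrix.diagonal (frameD V)) (Matrix.diagonal (lineVec (HodgeCM.CMField.K F) ((a : ↥(maximalRealSubfield (HodgeCM.CMField.K F))) :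
              (HodgeCM.CMField.K F))))))).comp (MonoidHom.inr _ _))⁻¹ * ((lineChar (↥(maximalRealSubfield (HodgeCM.CMField.K F))) (HodgeCM.CMField.K F) (IsCMField.complexConj (HodgeCM.CMField.K F)) a χ.1).comp (MulEquiv.subgroupCongr (finAdelic_JW_eq (HodgeCM.CMField.K F) a)).symm.toMonoidHom)) u) ∧
        ∃ Φf : FinSB (↥(maximalRealSubfield (HodgeCM.CMField.K F))) (Fin 3), (distDatumAt V hμ.cmType ι₁ ((a : ↥(maximalRealSubfield (HodgeCM.CMField.K F))) : (HodgeCM.CMField.K F)) ha ha0 (1 : CMAdelic (HodgeCM.CMField.K F) (frameD V) × CMAdelic (HodgeCM.CMField.K F) (dW (cDiag hμ.cmType ι₁ ((a : ↥(maximalRealSubfield (HodgeCM.CMField.K F)))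
            : (HodgeCM.CMField.K F)) ha ha0).D) →* ℂˣ) (one_apply_rat_eq_one V (cDiag hμ.cmType ι₁ ((a : ↥(maximalRealSubfield (HodgeCM.CMField.K F))) : (HodgeCM.CMField.K F)) ha ha0)) (continuous_one_val V (cDiag hμ.cmType ι₁ ((a : ↥(maximalRealSubfield (HodgeCM.CMField.K F))) : (HodgeCM.CMField.K F)) ha ha0)) ((cmLineChar₀ (HodgeCM.CMField.K
            F) finProdFinEquiv e₁ (frameD V) (frameD_real V) (frameD_ne V) (dW (cDiag hμ.cmType ι₁ ((a : ↥(maximalRealSubfield (HodgeCM.CMField.K F))) : (HodgeCM.CMField.K F)) ha ha0).D) (dW_real (cDiag hμ.cmType ι₁ ((a : ↥(maximalRealSubfield (HodgeCM.CMField.K F))) : (HodgeCM.CMField.K F)) ha ha0).D) (dW_ne (cDiag hμ.cmType ι₁ ((a :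
            ↥(maximalRealSubfield (HodgeCM.CMField.K F))) : (HodgeCM.CMField.K F)) ha ha0).D) (compat_plane V hμ.cmType ι₁ ((a : ↥(maximalRealSubfield (HodgeCM.CMField.K F))) : (HodgeCM.CMField.K F)) ha ha0) (compat_line₀ V hμ.cmType ι₁ ((a : ↥(maximalRealSubfield (HodgeCM.CMField.K F))) : (HodgeCM.CMField.K F)) ha ha0) (compat_line₁ V hμ.cmType ι₁
            ((a : ↥(maximalRealSubfield (HodgeCM.CMField.K F))) : (HodgeCM.CMField.K F)) ha ha0)).comp (MonoidHom.inl _ _) * (ĉ.comp (UnitaryGroup.adelicInl (↥(maximalRealSubfield (HodgeCM.CMField.K F))) (HodgeCM.CMField.K F) (IsCMField.complexConj (HodgeCM.CMField.K F)) 3 1 (Matrix.diagonal (frameD V)) (Matrix.diagonal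
            (lineVec (HodgeCM.CMField.K F) ((a : ↥(maximalRealSubfield (HodgeCM.CMField.K F))) : (HodgeCM.CMField.K F))))))⁻¹) hν hνc A hV (blockFamilyOfAt (HodgeCM.CMField.K F) e₁ (frameD V) (frameD_real V) (frameD_ne V) (lineVec (HodgeCM.CMField.K F) (dW (cDiag hμ.cmType ι₁ ((a : ↥(maximalRealSubfield (HodgeCM.CMField.K F))) :
            (HodgeCM.CMField.K F)) ha ha0).D 0)) (fun _ => dW_real (cDiag hμ.cmType ι₁ ((a : ↥(maximalRealSubfield (HodgeCM.CMField.K F))) : (HodgeCM.CMField.K F)) ha ha0).D 0) (fun _ => dW_ne (cDiag hμ.cmType ι₁ ((a : ↥(maximalRealSubfield (HodgeCM.CMField.K F))) : (HodgeCM.CMField.K F)) ha ha0).D 0) ι₁ (blockPosEquiv V) (blockNegEquiv V)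
            (posIdxEquivUnit hpos) (negIdxEquivEmpty hpos) (degOnePDual Empty) (binvPi 1)) harm hdef).dist (charInv χM) Φf ≠ 0) :
  ∀ (L : Type) [Field L] [NumberField L] [IsCMField L] (ι : L →+* ℂ) (H : Matrix (Fin 3) (Fin 3) L) (T : GL (Fin 3) ℂ)
    (hT : (T : Matrix (Fin 3) (Fin 3) ℂ)ᴴ * H.map ι * (T : Matrix (Fin 3) (Fin 3) ℂ) = Literature.Geometry.ComplexHyperbolic.BallModel.J),
    (∀ τ' : L →+* ℂ, InfinitePlace.mk τ' ≠ InfinitePlace.mk ι → (H.map τ').PosDef) → 2 ≤ Module.finrank ℚ ↥(maximalRealSubfield L) →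
    ∀ {n' : ℕ} (e₁ : Fin 3 × Fin 1 ≃ Fin n') (dV : Fin 3 → L) (hdV : ∀ i, IsCMField.complexConj L (dV i) = dV i)
      (hdV0 : ∀ i, dV i ≠ 0) (g : GL (Fin 3) L)
      (hg : ((g : Matrix (Fin 3) (Fin 3) L).map (cmConjRingHom L))ᵀ * H * (g : Matrix (Fin 3) (Fin 3) L) = Matrix.diagonal dV)
      (ιV : finAdelic (↥(maximalRealSubfield L)) L (IsCMField.complexConj L) 3 H →*
          finAdelic (↥(maximalRealSubfield L)) L (IsCMField.complexConj L) 3 (Matrix.diagonal dV)),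
        (∀ k, ((ιV k : finAdelic (↥(maximalRealSubfield L)) L (IsCMField.complexConj L) 3 (Matrix.diagonal dV)) :
            GL (Fin 3) (FiniteAdeleRing (𝓞 L) L)) =
          (toFinAdeleGL L 3 g)⁻¹ * (k : GL (Fin 3) (FiniteAdeleRing (𝓞 L) L)) * toFinAdeleGL L 3 g) →
        ∀ (μ : Literature.NumberTheory.Automorphic.IdeleClassGroup L →ₜ* Circle) (hμ : IsConjugateSymplectic L μ), HasWeight L μ 1 →
          ∀ (a : (↥(maximalRealSubfield L))ˣ) (χ : Chi (↥(maximalRealSubfield L)) L (IsCMField.complexConj L)),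
            (∃ e : L, IsAdmissibleElement L hμ.cmType.1 e ∧
                epsOf (↥(maximalRealSubfield L)) (imagUnitSq L) L (2 * imagUnit L)⁻¹ e = locF (↥(maximalRealSubfield L)) (imagUnitSq L) a) →
              (InfinitePlace.mk ι).embedding = ι → ι ∈ hμ.cmType.1 →
              ∃ θ : (omegaAtLine (↥(maximalRealSubfield L)) L (IsCMField.complexConj L) 3 e₁ (Matrix.diagonal dV)
                      (complexConj_imagUnit L) (imagUnit_ne_zero L) (imagUnit_mul_self L) (realDiagonal_isSymm L dV hdV)
                      (isUnit_det_realDiagonal L dV hdV hdV0) (realDiagonal_map L dV hdV).symm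
                      (fun a => isCompatible_chiSplittingLine L e₁ dV hdV hdV0 (toHeckeCharacter L μ)
                        (isUnitary_toHeckeCharacter L μ) ((isOscillatorChar_toHeckeCharacter_iff μ).mpr hμ)
                        (TW (↥(maximalRealSubfield L)) a) (isSymm_TW (↥(maximalRealSubfield L)) a)
                        (isUnit_det_TW (↥(maximalRealSubfield L)) a) (JW (↥(maximalRealSubfield L)) L a)
                        (JW_eq (↥(maximalRealSubfield L)) L a)) a χ) →ₗ[ℂ]
                    ((adelicGroupData (↥(maximalRealSubfield L)) L (IsCMField.complexConj L) 3 H).Adelic → (Fin 2 → ℂ)),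
                θ ≠ 0 ∧
                (∀ w, θ w ∈ CotangentForms.cohForms (↥(maximalRealSubfield L)) L (IsCMField.complexConj L) 3 H
                    (cmArchSection L ι H T hT) (cmCompactFactor L ι H T hT)) ∧
                ∀ (k : ↥(finAdelic (↥(maximalRealSubfield L)) L (IsCMField.complexConj L) 3 H)) w,
                  θ (rhoAtLine (↥(maximalRealSubfield L)) L (IsCMField.complexConj L) 3 e₁ (Matrix.diagonal dV)
                      (complexConj_imagUnit L) (imagUnit_ne_zero L) (imagUnit_mul_self L) (realDiagonal_isSymm L dV hdV)
                      (isUnit_det_realDiagonal L dV hdV hdV0) (realDiagonal_map L dV hdV).symm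
                      (fun a => isCompatible_chiSplittingLine L e₁ dV hdV hdV0 (toHeckeCharacter L μ)
                        (isUnitary_toHeckeCharacter L μ) ((isOscillatorChar_toHeckeCharacter_iff μ).mpr hμ)
                        (TW (↥(maximalRealSubfield L)) a) (isSymm_TW (↥(maximalRealSubfield L)) a)
                        (isUnit_det_TW (↥(maximalRealSubfield L)) a) (JW (↥(maximalRealSubfield L)) L a)
                        (JW_eq (↥(maximalRealSubfield L)) L a)) ιV a χ k w) =
                    fun x => θ w (x * finAdelicToAdelic (↥(maximalRealSubfield L)) L (IsCMField.complexConj L) 3 H k)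
 := by
  intro L _ _ _ ι H T hT hHpos h2 n' eV dV hdV hdV0 g hg ιV hιV μ hμ hw a χ hadm hemb hι
  -- (a′): reduce to an admissible representative `a′ = e · 2δ_L` of the collection `locF a` (★ R3)
  refine F0P2sThetaOccursInLineTransport.thetaOccursInClause_of_admissibleRepresentative L 3 H eV dV hdV hdV0 ιV μ hμ χ _
    hμ.cmType.1 a hadm fun e he a' hae => ?_
  -- (An): the packaged frame is anisotropic since `[L:ℚ] = 2[L⁺:ℚ] ≥ 4`
  have hV : IsAnisotropic (cmFieldOf L) (HodgeCM.HermSpace3.Hm (hermSpace3Of L ι H T hT hHpos)) :=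
    (HodgeCM.HermSpace3.isAnisotropic_iff_finrank_ne_two (hermSpace3Of L ι H T hT hHpos)).2 (by
      have h4 := four_le_finrank_of_two_le (L := L) h2
      show Module.finrank ℚ L ≠ 2
      omega)
  -- (E): the engine (i) at `(cmFieldOf L, hermSpace3Of …, a′)` fed with the χN-GEN row
  have hE := F0P2sThetaOccursInEngineGen.exists_holTheta_atFrame_of_chiN (cmFieldOf L) (hermSpace3Of L ι H T hT hHpos) hV hemb
    hμ.cmType μ hμ hw hι χ e a' he hae (hX (cmFieldOf L) (hermSpace3Of L ι H T hT hHpos) hV hemb μ hμ hw hι χ e a' he hae)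
  -- (Ta)∘(Tf): ★ p844332 to the letter's frame `(dV, g, ιV)` and `cohForms (cmArchSection, cmCompactFactor)`, at the model enumeration
  have hA := F0P2sThetaOccursInOutputAdapter.thetaOccursInClause_of_pinFrame_archFactorOf (cmFieldOf L) (hermSpace3Of L ι H T hT hHpos) T hT
    HodgeCM.Model.ArchSideTerm.e₁ dV hdV hdV0 g hg ιV hιV μ hμ a' χ hE
  -- §1: the letter's enumeration `eV`
  exact thetaOccursInClause_of_reindex L 3 H eV HodgeCM.Model.ArchSideTerm.e₁ dV hdV hdV0 ιV μ hμ a' χ _ hA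

end Summit.HodgeConjecture.HodgeConjecture.Cruxes.H413.F0P2sThetaOccursInOfEngine

end
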